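import Mathlib
import HarnessLib
import Summits.ResolutionOfSingularities.ResolutionOfSingularities.Theorems.WildQuotientsWildQuotientResolutionS1aKillFreeFTools
import Summits.ResolutionOfSingularities.ResolutionOfSingularities.Theorems.WildQuotientsWildQuotientResolutionS1aBlowupIdleChart

/-!
# S1a — K-FREE FRAME, producer tools II: a NAMED KILL lowers `μ_F` (measure half — the atlas bookkeeping of the realisation enters as two hypotheses)

[OURS · L1 W4.5c · lead-1 g11; plan-1 ASSIGNMENT v10.34 «(F-T2) → (F-T3) → treeF_one_of_namedKill»; A-KF v0 (O3)/(O5)] — NOT statements of the manuscript; counted 0;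
AI-level work, weaker than expert review. Crux stmt-ResolutionOfSingularities-17941 `CyclicQuotientFourfolds`, line `s1a-logminvertex` v12 (`stub_reachLowerInF`). Route-independent.

THE (KN) NODE OF A TREE. At a decorated model `(M, 𝔄)` the producer NAMES a principal centre `(𝒦, d)` whose support meets a TOP component `t` of the carried formal locus `F_𝔄`; every
realisation `π′ : M′ → M` is re-decorated by `𝔄′ :=` (transports of the old charts OFF the kill-open) ∪ (the killed producer charts OVER the kill-open). This file proves the
MEASURE HALF: whenever the re-decoration satisfies the two bookkeeping clauses
  (B-over) every point of `M′` over the kill-open `⋃ {principal-centre charts}` is principal near some chart of `𝔄′` (KILLEDNESS = own principality of the producer charts), and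
  (B-off)  at points of `M′` NOT over the kill-open, `v′ ∈ F_𝔄′ ↔ π′ v′ ∈ F_𝔄` (transport of the old charts along the isomorphism off the support),
then `LexLTF M′ 𝔄′ M 𝔄`: `F_𝔄′ ≅ F_𝔄 ∖ killOpen`, a CLOSED subset of `F_𝔄` missing the top component `t` (`t` meets `supp ⊆ killOpen`).
The construction of `𝔄′` with (B-over)/(B-off) ((F-T2) node-data transport, (F-T3) killed blow-up charts) is the companion file `…S1aKillFreeTransport`.

* `support_subset_principalKillOpen` — the support of a principal centre lies in the union of its principal-centre charts (idle charts miss it);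
* `TopCount.nTopComp_lt_of_isEmbedding_of_not_subset_closure` — embedding of equal finite dimension whose range-closure omits a top component ⇒ fewer top components;
* ★★ `GModel.lexLTF_of_principalMove_of_bookkeeping` — the measure half of `treeF_one_of_namedKill`;
* ★ `GModel.treeF_one_of_namedKill_of_bookkeeping` — the depth-1 `TreeF` node, given a `P`-decoration with bookkeeping of every realisation.
-/

set_option linter.dupNamespace false

noncomputable section

open CategoryTheory Limits AlgebraicGeometry TopologicalSpace Topology
open Literature.AlgebraicGeometry.Resolution Literature.AlgebraicGeometry.RelativeSpec
open Summit.ResolutionOfSingularities.ResolutionOfSingularities.Theorems.WildQuotientResolution.S1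
open Summit.ResolutionOfSingularities.ResolutionOfSingularities.Theorems.WildQuotientResolution.S1.NodeAtlas
open Summit.ResolutionOfSingularities.ResolutionOfSingularities.Theorems.WildQuotientResolution.S1.CompCount
open Summit.ResolutionOfSingularities.ResolutionOfSingularities.Theorems.WildQuotientResolution.S1.NpFrame
open Summit.ResolutionOfSingularities.ResolutionOfSingularities.Theorems.WildQuotientResolution.S1.KillableTransport
open Summit.ResolutionOfSingularities.ResolutionOfSingularities.Theorems.WildQuotientResolution.S1.BlowupCharts

namespace Summit.ResolutionOfSingularities.ResolutionOfSingularities.Theorems.WildQuotientResolution.S1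

/-! ## Top components: closed-range variant -/

namespace TopCount

universe u v

variable {X : Type u} {Y : Type v} [TopologicalSpace X] [TopologicalSpace Y]

/-- **An embedding of spaces of the same finite dimension whose range-closure does not contain some top component lowers the number of top components.**
[OURS · L1 W4.5c] -/
theorem nTopComp_lt_of_isEmbedding_of_not_subset_closure {ψ : Y → X} (hψ : IsEmbedding ψ) {k : ℕ} (hX : topologicalKrullDim X = k)
    (hY : topologicalKrullDim Y = k) (hfin : (irreducibleComponents X).Finite)
    {t : Set X} (ht : t ∈ irreducibleComponents X) (hdt : topologicalKrullDim ↥t = k) (htr : ¬ t ⊆ closure (Set.range ψ)) :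
    nTopComp Y < nTopComp X := by
  let Φ : Set Y → Set X := fun T' => closure (ψ '' T')
  have hmaps : Set.MapsTo Φ (topComponents Y) (topComponents X \ {t}) := by
    intro T' hT'
    have hdT' : topologicalKrullDim ↥T' = k := hT'.2.trans hY
    obtain ⟨hmem, hdim⟩ := closure_image_mem_topComponents hψ hX.le hT'.1 hdT'
    refine ⟨⟨hmem, hdim.trans hX.symm⟩, fun h => ?_⟩
    rw [Set.mem_singleton_iff] at h
    exact htr (h ▸ closure_mono (Set.image_subset_range ψ T'))
  have hinj : Set.InjOn Φ (topComponents Y) := by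
    intro T₁ hT₁ T₂ hT₂ h
    have h1 := image_eq_closure_inter_range hψ (isClosed_of_mem_irreducibleComponents _ hT₁.1)
    have h2 := image_eq_closure_inter_range hψ (isClosed_of_mem_irreducibleComponents _ hT₂.1)
    have h3 : ψ '' T₁ = ψ '' T₂ := by rw [h1, h2]; exact congrArg (· ∩ Set.range ψ) h
    exact hψ.injective.image_injective h3
  have hfinX : (topComponents X).Finite := hfin.subset (topComponents_subset X)
  have htmem : t ∈ topComponents X := ⟨ht, hdt.trans hX.symm⟩
  calc nTopComp Y = (topComponents Y).ncard := rfl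
    _ = (Φ '' topComponents Y).ncard := (hinj.ncard_image).symm
    _ ≤ (topComponents X \ {t}).ncard := Set.ncard_le_ncard hmaps.image_subset hfinX.sdiff
    _ < (topComponents X).ncard := Set.ncard_sdiff_singleton_lt_of_mem htmem hfinX
    _ = nTopComp X := rfl

end TopCount

namespace GameFrame.GModel

variable {p : ℕ} {X' X₁ : Scheme.{0}} {q : X' ⟶ X₁} {G : Type} [Group G] {ρ : G →* Aut X'} {g₀ : G}

/-- **The support of a principal centre lies in its kill-open** (the union of its principal-centre charts): an idle chart misses the support.
[OURS · L1 W4.5c] -/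
theorem support_subset_principalKillOpen (M : GModel p q G ρ g₀) {𝒦 : ReesFiltration M.V} {d : ℕ} (hprin : IsPrincipalCentre p M.act g₀ 𝒦 d) :
    (((𝒦.ideal d).support : Set M.V)) ⊆ M.principalKillOpen 𝒦 d := by
  intro v hv
  obtain ⟨O, hvO, hO | hO⟩ := hprin.2.2 v
  · exact Set.mem_iUnion.mpr ⟨O, Set.mem_iUnion.mpr ⟨hO, hvO⟩⟩
  · exact absurd hv (Set.disjoint_left.mp
      (disjoint_support_of_ideal_eq_top hO.1.1 (by rw [← ReesFiltration.filtration_ideal]; exact hO.2 d)) hvO)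

/-- ★★ **A NAMED KILL LOWERS `μ_F` — measure half.** `(M, 𝔄)` decorated, compact with `dim F_𝔄` finite; `(𝒦, d)` a principal centre whose support meets a TOP component `t`
of `F_𝔄`; `π′ : M′ → M` a realisation (blow-up of `𝒦.ideal d`, structure maps and actions compatible); `𝔄′` a decoration of `M′` with the bookkeeping clauses (B-over) and
(B-off). Then `LexLTF M′ 𝔄′ M 𝔄`. [OURS · L1 W4.5c · A-KF v0 (O5)] -/
theorem lexLTF_of_principalMove_of_bookkeeping (M M' : GModel p q G ρ g₀) [CompactSpace M.V] (𝔄 : NodeAtlasData p M.act g₀) {n : ℕ} (hdim : M.fdim 𝔄 < n)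
    (𝒦 : ReesFiltration M.V) (d : ℕ) (hprin : IsPrincipalCentre p M.act g₀ 𝒦 d)
    {t : Set ↥𝔄.fLocus} (ht : t ∈ irreducibleComponents ↥𝔄.fLocus) (hdt : topologicalKrullDim ↥t = M.fdim 𝔄)
    (htouch : ∃ x ∈ t, (x : M.V) ∈ ((𝒦.ideal d).support : Set M.V))
    (π' : M'.V ⟶ M.V) (hbl : IsBlowup π' (𝒦.ideal d))
    (𝔄' : NodeAtlasData p M'.act g₀)
    (hover : ∀ v' : M'.V, π'.base v' ∈ M.principalKillOpen 𝒦 d → v' ∉ 𝔄'.fLocus)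
    (hoff : ∀ v' : M'.V, π'.base v' ∉ M.principalKillOpen 𝒦 d → (v' ∈ 𝔄'.fLocus ↔ π'.base v' ∈ 𝔄.fLocus)) :
    LexLTF M' 𝔄' M 𝔄 := by
  have hsuppK := M.support_subset_principalKillOpen hprin
  let W : M.V.Opens := (𝒦.ideal d).support.compl
  -- points of `F_𝔄′` lie off the kill-open, hence off the support
  have hoffK : ∀ v' : ↥𝔄'.fLocus, π'.base v'.1 ∉ M.principalKillOpen 𝒦 d := fun v' h => hover v'.1 h v'.2
  have hW : ∀ v' : ↥𝔄'.fLocus, v'.1 ∈ π' ⁻¹ᵁ W := fun v' h => hoffK v' (hsuppK h)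
  have key : ∀ v' : ↥𝔄'.fLocus, π'.base v'.1 ∈ 𝔄.fLocus := fun v' => (hoff v'.1 (hoffK v')).mp v'.2
  haveI hiso : IsIso (π' ∣_ W) := hbl.isIso_morphismRestrict (U := W) (by
    rw [Set.disjoint_iff]; rintro x ⟨hx, hx'⟩; exact hx hx')
  let e : ↥(π' ⁻¹ᵁ W) ≃ₜ ↥W := Scheme.homeoOfIso (asIso (π' ∣_ W))
  let φ₀ : ↥𝔄'.fLocus → M.V := fun v' => ((e ⟨v'.1, hW v'⟩ : ↥W) : M.V)
  have hφ₀ : ∀ v', φ₀ v' = π'.base v'.1 := fun v' => by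
    have h1 : (e ⟨v'.1, hW v'⟩ : ↥W) = (π' ∣_ W).base ⟨v'.1, hW v'⟩ := rfl
    change ((e ⟨v'.1, hW v'⟩ : ↥W) : M.V) = _
    rw [h1]
    exact morphismRestrict_base_coe π' W ⟨v'.1, hW v'⟩
  have hind₀ : IsInducing φ₀ := by
    refine IsInducing.subtypeVal.comp (e.isInducing.comp ?_)
    exact (IsInducing.subtypeVal.codRestrict hW : IsInducing fun v' : ↥𝔄'.fLocus => (⟨v'.1, hW v'⟩ : ↥(π' ⁻¹ᵁ W)))
  have hinj₀ : Function.Injective φ₀ := by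
    intro a b hab
    have h1 : (e ⟨a.1, hW a⟩ : ↥W) = e ⟨b.1, hW b⟩ := Subtype.ext hab
    have h2 := e.injective h1
    exact Subtype.ext (congrArg (fun x : ↥(π' ⁻¹ᵁ W) => (x : M'.V)) h2)
  have hmem₀ : ∀ v', φ₀ v' ∈ 𝔄.fLocus := fun v' => by rw [hφ₀]; exact key v'
  let ψ : ↥𝔄'.fLocus → ↥𝔄.fLocus := Set.codRestrict φ₀ 𝔄.fLocus hmem₀
  have hψ : IsEmbedding ψ := ⟨hind₀.codRestrict hmem₀, (Set.injective_codRestrict hmem₀).mpr hinj₀⟩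
  -- the range is the closed set `F_𝔄 ∖ killOpen`
  have hrange : Set.range ψ = {z : ↥𝔄.fLocus | (z : M.V) ∉ M.principalKillOpen 𝒦 d} := by
    ext z
    constructor
    · rintro ⟨v', rfl⟩
      change φ₀ v' ∉ _
      rw [hφ₀]
      exact hoffK v'
    · intro hz
      have hzs : (z : M.V) ∉ ((𝒦.ideal d).support : Set M.V) := fun h => hz (hsuppK h)
      let w : ↥W := ⟨(z : M.V), hzs⟩
      let v₀ : ↥(π' ⁻¹ᵁ W) := e.symm w
      have hv₀ : π'.base v₀.1 = z := by
        have h1 : ((e v₀ : ↥W) : M.V) = π'.base v₀.1 := by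
          have h2 : (e v₀ : ↥W) = (π' ∣_ W).base v₀ := rfl
          rw [h2]; exact morphismRestrict_base_coe π' W v₀
        rw [← h1]
        change ((e (e.symm w) : ↥W) : M.V) = _
        rw [e.apply_symm_apply]
      have hz' : π'.base v₀.1 ∉ M.principalKillOpen 𝒦 d := by rw [hv₀]; exact hz
      have hF' : v₀.1 ∈ 𝔄'.fLocus := (hoff v₀.1 hz').mpr (hv₀ ▸ z.2)
      refine ⟨⟨v₀.1, hF'⟩, Subtype.ext ?_⟩
      change φ₀ _ = _
      rw [hφ₀]
      exact hv₀
  have hclosed : IsClosed (Set.range ψ) := by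
    rw [hrange]
    have : {z : ↥𝔄.fLocus | (z : M.V) ∉ M.principalKillOpen 𝒦 d} = Subtype.val ⁻¹' (M.principalKillOpen 𝒦 d)ᶜ := rfl
    rw [this]
    exact (M.isOpen_principalKillOpen 𝒦 d).isClosed_compl.preimage continuous_subtype_val
  -- compare dimensions, then top counts
  have hle : M'.fdim 𝔄' ≤ M.fdim 𝔄 := hψ.isInducing.topologicalKrullDim_le
  rcases hle.lt_or_eq with hlt | heq
  · exact Or.inl hlt
  have hbot : M.fdim 𝔄 ≠ ⊥ := by
    intro hbot
    rw [fdim, topologicalKrullDim, Order.krullDim_eq_bot_iff] at hbot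
    obtain ⟨x, -⟩ := ht.1.nonempty
    exact hbot.elim ⟨closure {x}, isIrreducible_singleton.closure, isClosed_closure⟩
  obtain ⟨k, hk⟩ := exists_nat_eq_of_ne_bot_of_lt hbot hdim
  have htr : ¬ t ⊆ closure (Set.range ψ) := by
    rw [hclosed.closure_eq, hrange]
    intro hsub
    obtain ⟨x, hxt, hxs⟩ := htouch
    exact hsub hxt (hsuppK hxs)
  exact Or.inr ⟨heq, Or.inl (TopCount.nTopComp_lt_of_isEmbedding_of_not_subset_closure hψ hk (heq.trans hk)
    (M.finite_irreducibleComponents_fLocus 𝔄) ht (hdt.trans hk) htr)⟩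

/-- ★ **THE (KN) NODE — from bookkeeping**: a NAMED principal centre at `(M, 𝔄)` whose support meets a top component of `F_𝔄`, together with, for every realisation, a
`P`-decoration satisfying (B-over)/(B-off), is a depth-1 `TreeF` reaching `μ_F`-lower decorated models. [OURS · L1 W4.5c · A-KF v0 (KN)] -/
theorem treeF_one_of_namedKill_of_bookkeeping {P : ∀ N : GModel p q G ρ g₀, NodeAtlasData p N.act g₀ → Prop}
    (M : GModel p q G ρ g₀) [CompactSpace M.V] (𝔄 : NodeAtlasData p M.act g₀) {n : ℕ} (hdim : M.fdim 𝔄 < n)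
    (𝒦 : ReesFiltration M.V) (d : ℕ) (hprin : IsPrincipalCentre p M.act g₀ 𝒦 d)
    {t : Set ↥𝔄.fLocus} (ht : t ∈ irreducibleComponents ↥𝔄.fLocus) (hdt : topologicalKrullDim ↥t = M.fdim 𝔄)
    (htouch : ∃ x ∈ t, (x : M.V) ∈ ((𝒦.ideal d).support : Set M.V))
    (hdec : ∀ (M' : GModel p q G ρ g₀) (π' : M'.V ⟶ M.V), IsBlowup π' (𝒦.ideal d) → M'.π = π' ≫ M.π → M'.r = π' ≫ M.r →
      (∀ g : G, (M'.act.aut g).hom ≫ π' = π' ≫ (M.act.aut g).hom) →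
      ∃ 𝔄' : NodeAtlasData p M'.act g₀, P M' 𝔄' ∧
        (∀ v' : M'.V, π'.base v' ∈ M.principalKillOpen 𝒦 d → v' ∉ 𝔄'.fLocus) ∧
        (∀ v' : M'.V, π'.base v' ∉ M.principalKillOpen 𝒦 d → (v' ∈ 𝔄'.fLocus ↔ π'.base v' ∈ 𝔄.fLocus))) :
    TreeF P (fun N 𝔅 => LexLTF N 𝔅 M 𝔄) 1 M 𝔄 := by
  refine Or.inr (Or.inr ⟨𝒦, d, isAdmissibleCentre_of_isPrincipalCentre hprin, fun M' hm => ?_⟩)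
  obtain ⟨π', hbl, hπ, hr, hcomm⟩ := hm
  obtain ⟨𝔄', hP, hover, hoff⟩ := hdec M' π' hbl hπ hr hcomm
  exact ⟨𝔄', hP, lexLTF_of_principalMove_of_bookkeeping M M' 𝔄 hdim 𝒦 d hprin ht hdt htouch π' hbl 𝔄' hover hoff⟩

end GameFrame.GModel

end Summit.ResolutionOfSingularities.ResolutionOfSingularities.Theorems.WildQuotientResolution.S1

end
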